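import Literature.NumberTheory.Automorphic.NewformAdelisationHecke
import Literature.NumberTheory.Automorphic.NewformAdelisationHeckeOperatorClassical
import HarnessLib

/-!
# Adelisation of classical modular forms, IV-c': the unramified Hecke operators on the lift of an
arbitrary cusp form (`T̃(p) φ_f = φ_{T_p f}`, `R(p) φ_f = φ_{⟨p⟩ f}`; Gelbart 1975, Lemma 3.7)

Topic `NumberTheory/Automorphic`; operator-level form of `NewformAdelisationHecke` (which computes the
Hecke *eigenvalues* of the lift of a *newform*). For the dictionary in the direction `φ ↦ f_φ`
(Gelbart 1997, Prop. 2.5, converse) the identities are needed for every `f ∈ S_k(Γ₁(N))`, before any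
eigen-assumption:

* `sum_adelicLiftFun_ofRealGL_mul_eq_lift_heckeT`, `sum_adelicLiftFun_mul_eq_lift_heckeT` —
  **`∑ⱼ φ_f(h yⱼ) = φ_{T_p f}(h) / (√p)^{k-2}`** for `p ∤ N` and every `h ∈ GL₂(𝔸_ℚ)`, `{yⱼ}` the
  `p + 1` local representatives of `K_p diag(p,1) K_p / K_p` placed at `p` (Gelbart 1975, Lemma 3.7:
  `p^{k/2-1} T̃(p) φ_f = φ_{T(p) f}`; classical input `sum_archLift_heckeBeta_inv_mul_eq` of
  `NewformAdelisationHeckeOperatorClassical`);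
* `adelicLiftFun_mul_heckeDiagAt_two_eq_lift_diamondOp` — **`φ_f(h · diag(ϖ,ϖ)_p) = φ_{⟨p⟩ f}(h)`**
  (Bump 1997, (6.4): `ℝ_p`; classical input `slash_bezoutDelta_inv_eq_diamondOp`);
* `adelicLiftFunA` (`φ_f` typed on the trunk's function space) and
  `heckeOperator_principalCongruenceLevel_adelicLiftFunA_one/two` — the same as identities for the
  Hecke operators `[K(N) diag(ϖ,1)_p K(N)]`, `[K(N) diag(ϖ,ϖ)_p K(N)]` of `HasSatakeParamAt`
  (`AutomorphicRepsGL`) acting on the function `φ_f` (`heckeOperator_apply_eq_sum` with the transversal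
  `Rat.bijOn_range_ofLocal_heckeLocalRep`, `heckeOperator_apply_of_mem_center`).

Everything is proved; the one definition is the typed alias `adelicLiftFunA`.

## References

* S. Gelbart, *Automorphic forms on adele groups* (1975), §3.B, (3.15), Lemma 3.7 and its proof,
  pp. 31–32 [Gelbart1975].
* D. Bump, *Automorphic forms and representations* (1997), §3.6, (6.4), (6.7), p. 342 [Bump1997].
-/

noncomputable section

open Matrix NumberField IsDedekindDomain UpperHalfPlane MeasureTheory
open scoped MatrixGroups ModularForm NNReal ENNReal

namespace Literature.NumberTheory.Automorphic

open EllipticCurves.ModularForms CongruenceSubgroup Rat.HeightOneSpectrum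

section Pointwise

variable {N : ℕ} [NeZero N] {k : ℤ} (f : CuspForm (Gamma1 N) k) {v : HeightOneSpectrum (𝓞 ℚ)}

/-- `p = natGenerator v ≠ 0`, as an instance for `heckeT`. [folklore] -/
theorem neZero_natGenerator (v : HeightOneSpectrum (𝓞 ℚ)) : NeZero (natGenerator v) :=
  ⟨(prime_natGenerator v).ne_zero⟩

attribute [local instance] neZero_natGenerator

/-- **Lemma 3.7 at the archimedean points, for an arbitrary cusp form**: for `f ∈ S_k(Γ₁(N))`,
`p ∤ N` and `det g_∞ > 0`, `∑ⱼ φ_f((g_∞, 1) yⱼ) = φ_{T_p f}((g_∞, 1)) / (√p)^{k-2}`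
(`adelicLiftFun_ofRealGL_mul_eq_archLift` and `sum_archLift_heckeBeta_inv_mul_eq`).
[cite: Gelbart1975, Lemma 3.7] -/
theorem sum_adelicLiftFun_ofRealGL_mul_eq_lift_heckeT (hv : ¬ v.asIdeal ∣ Ideal.span {(N : 𝓞 ℚ)})
    {a b' d' : ℤ} (had : a * d' - b' * N = 1) (hap : (N : ℤ) ∣ a - natGenerator v)
    {g : GL (Fin 2) ℝ} (hg : 0 < g.det.val) :
    ∑ j : Option (Fin (natGenerator v)), adelicLiftFun N k f (Rat.ofRealGL 2 g * GLn.ofLocal 2 ℚ v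
      (heckeLocalRep (Rat.localUniformizer v : v.adicCompletion ℚ)
        (fun i : Fin (natGenerator v) => algebraMap ℚ (v.adicCompletion ℚ) ((i : ℕ) : ℚ))
        (Rat.localUniformizer v).ne_zero j)) =
      adelicLiftFun N k (EllipticCurves.ModularForms.heckeT (Gamma1 N) k (natGenerator v) f) (Rat.ofRealGL 2 g) /
        (((Real.sqrt (natGenerator v) : ℝ) : ℂ) ^ (k - 2)) := by
  have hpN : ¬ natGenerator v ∣ N := fun h => hv ((Rat.natGenerator_dvd_iff v N).1 h)
  have hterm : ∀ j : Option (Fin (natGenerator v)), adelicLiftFun N k f (Rat.ofRealGL 2 g * GLn.ofLocal 2 ℚ v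
      (heckeLocalRep (Rat.localUniformizer v : v.adicCompletion ℚ)
        (fun i : Fin (natGenerator v) => algebraMap ℚ (v.adicCompletion ℚ) ((i : ℕ) : ℚ))
        (Rat.localUniformizer v).ne_zero j)) =
      archLift k f ((Matrix.GeneralLinearGroup.map (Rat.castHom ℝ)
        (heckeBeta (natGenerator v) a b' d' N (prime_natGenerator v).ne_zero had j))⁻¹ * g) := fun j =>
    adelicLiftFun_ofRealGL_mul_eq_archLift f hg
      (by rw [val_det_heckeBeta]; exact_mod_cast (prime_natGenerator v).pos)
      (Rat.archGL_ofLocal_heckeLocalRep j)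
      (Rat.globalToLocal_heckeBeta_inv_mul_mem_localGammaOne hv had hap j)
  simp_rw [hterm]
  rw [sum_archLift_heckeBeta_inv_mul_eq (natGenerator v) (prime_natGenerator v) a b' d' had hap hpN f hg,
    adelicLiftFun_ofRealGL (EllipticCurves.ModularForms.heckeT (Gamma1 N) k (natGenerator v) f) hg]

/-- **Gelbart's Lemma 3.7, pointwise on `GL₂(𝔸_ℚ)`, for an arbitrary cusp form**: for
`f ∈ S_k(Γ₁(N))`, `v = p ∤ N` and every `h ∈ GL₂(𝔸_ℚ)`, `∑ⱼ φ_f(h yⱼ) = φ_{T_p f}(h) / (√p)^{k-2}`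
(write `h = γ (g_∞, 1) u`, drop `γ` and `u` — the same reductions apply to the cusp form `T_p f` —
and conclude by `sum_adelicLiftFun_ofRealGL_mul_eq_lift_heckeT`). [cite: Gelbart1975, Lemma 3.7]
[cite: Bump1997, §3.6, p. 342] -/
theorem sum_adelicLiftFun_mul_eq_lift_heckeT (hv : ¬ v.asIdeal ∣ Ideal.span {(N : 𝓞 ℚ)})
    (h : GL (Fin 2) (AdeleRing (𝓞 ℚ) ℚ)) :
    ∑ j : Option (Fin (natGenerator v)), adelicLiftFun N k f (h * GLn.ofLocal 2 ℚ v
      (heckeLocalRep (Rat.localUniformizer v : v.adicCompletion ℚ)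
        (fun i : Fin (natGenerator v) => algebraMap ℚ (v.adicCompletion ℚ) ((i : ℕ) : ℚ))
        (Rat.localUniformizer v).ne_zero j)) =
      adelicLiftFun N k (EllipticCurves.ModularForms.heckeT (Gamma1 N) k (natGenerator v) f) h /
        (((Real.sqrt (natGenerator v) : ℝ) : ℂ) ^ (k - 2)) := by
  have h𝔫 : Ideal.span {(N : 𝓞 ℚ)} ≠ 0 := Rat.span_natCast_ne_zero N
  have hpN : ¬ natGenerator v ∣ N := fun h => hv ((Rat.natGenerator_dvd_iff v N).1 h)
  obtain ⟨a, b', d', had, hap⟩ := exists_bezout_level N (natGenerator v) (prime_natGenerator v) hpN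
  -- `h = γ h₀`, `h₀ ∈ GL₂(ℝ)⁺ × K₁(N)`
  obtain ⟨γ, hγ⟩ := Rat.exists_ofGlobal_inv_mul_mem_plusLevelOne (Ideal.span {(N : 𝓞 ℚ)}) h
  set h₀ : GL (Fin 2) (AdeleRing (𝓞 ℚ) ℚ) := (GLn.ofGlobal 2 ℚ γ)⁻¹ * h with hh₀
  have hh : h = GLn.ofGlobal 2 ℚ γ * h₀ := by rw [hh₀, mul_inv_cancel_left]
  have hred : ∀ z, adelicLiftFun N k f (h * z) = adelicLiftFun N k f (h₀ * z) := fun z => by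
    rw [hh, mul_assoc, adelicLiftFun_ofGlobal_mul]
  have hred₀ : adelicLiftFun N k (EllipticCurves.ModularForms.heckeT (Gamma1 N) k (natGenerator v) f) h =
      adelicLiftFun N k (EllipticCurves.ModularForms.heckeT (Gamma1 N) k (natGenerator v) f) h₀ := by
    rw [hh, adelicLiftFun_ofGlobal_mul]
  simp_rw [hred]
  rw [hred₀]
  -- `h₀ = (g_∞, 1) u`, `u ∈ {1} × K₁(N)`
  have hdet : 0 < (Rat.archGL 2 h₀).det.val := (Rat.mem_plusLevelOne_iff.1 hγ).1
  set g : GL (Fin 2) ℝ := Rat.archGL 2 h₀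
  set u : GL (Fin 2) (AdeleRing (𝓞 ℚ) ℚ) := (Rat.ofRealGL 2 g)⁻¹ * h₀ with hudef
  have hu : u ∈ gammaOneLevel ℚ (Ideal.span {(N : 𝓞 ℚ)}) := Rat.ofRealGL_archGL_inv_mul_mem_gammaOneLevel hγ
  have hh₀' : h₀ = Rat.ofRealGL 2 g * u := by rw [hudef, mul_inv_cancel_left]
  obtain ⟨hU1, hU2, hU3⟩ := gammaOneLevel_local_hyps (K := ℚ) (v := v) h𝔫 hv
  rw [hh₀']
  simp_rw [mul_assoc]
  rw [sum_apply_mul_mul_eq_of_bijOn_cosets _ _ (Rat.bijOn_range_ofLocal_heckeLocalRep hU1 hU2 hU3)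
      (Rat.ofLocal_heckeLocalRep_injective hv) (adelicLiftFun N k f)
      (fun x z hz => adelicLiftFun_mul_of_mem_gammaOneLevel f x hz) hu,
    adelicLiftFun_mul_of_mem_gammaOneLevel (EllipticCurves.ModularForms.heckeT (Gamma1 N) k (natGenerator v) f) _ hu]
  exact sum_adelicLiftFun_ofRealGL_mul_eq_lift_heckeT f hv had hap hdet

/-- **`ℝ_p φ_f = φ_{⟨p⟩ f}` pointwise, for an arbitrary cusp form** (Bump 1997, §3.6, (6.4)): for
`f ∈ S_k(Γ₁(N))`, `v = p ∤ N` and every `h ∈ GL₂(𝔸_ℚ)`, `φ_f(h · diag(ϖ,ϖ)_v) = φ_{⟨p⟩ f}(h)`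
(with the rational matrix `β = δ (p·1)`, `δ⁻¹ ∈ Γ₀(N)` of lower right entry `a ≡ p`, and
`f ∣ δ⁻¹ = ⟨p⟩ f`, `slash_bezoutDelta_inv_eq_diamondOp`). [cite: Bump1997, §3.6, (6.4) and p. 342] -/
theorem adelicLiftFun_mul_heckeDiagAt_two_eq_lift_diamondOp (hv : ¬ v.asIdeal ∣ Ideal.span {(N : 𝓞 ℚ)})
    (h : GL (Fin 2) (AdeleRing (𝓞 ℚ) ℚ)) :
    adelicLiftFun N k f (h * heckeDiagAt 2 ℚ v (Rat.localUniformizer v) 2) =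
      adelicLiftFun N k (diamondOp N k ((natGenerator v : ℕ) : ZMod N) f) h := by
  have h𝔫 : Ideal.span {(N : 𝓞 ℚ)} ≠ 0 := Rat.span_natCast_ne_zero N
  have hp := prime_natGenerator v
  have hp0 : (0 : ℝ) < natGenerator v := Nat.cast_pos.mpr hp.pos
  have hpN : ¬ natGenerator v ∣ N := fun h => hv ((Rat.natGenerator_dvd_iff v N).1 h)
  obtain ⟨a, b', d', had, hap⟩ := exists_bezout_level N (natGenerator v) hp hpN
  set t₂ : GL (Fin 2) (AdeleRing (𝓞 ℚ) ℚ) := heckeDiagAt 2 ℚ v (Rat.localUniformizer v) 2 with ht₂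
  have ht₂c : t₂ ∈ Subgroup.center (GL (Fin 2) (AdeleRing (𝓞 ℚ) ℚ)) :=
    heckeDiagAt_self_mem_center (n := 2) v (Rat.localUniformizer v)
  -- `h = γ h₀`, `h₀ = (g_∞, 1) u`
  obtain ⟨γ, hγ⟩ := Rat.exists_ofGlobal_inv_mul_mem_plusLevelOne (Ideal.span {(N : 𝓞 ℚ)}) h
  set h₀ : GL (Fin 2) (AdeleRing (𝓞 ℚ) ℚ) := (GLn.ofGlobal 2 ℚ γ)⁻¹ * h with hh₀
  have hh : h = GLn.ofGlobal 2 ℚ γ * h₀ := by rw [hh₀, mul_inv_cancel_left]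
  have hdet : 0 < (Rat.archGL 2 h₀).det.val := (Rat.mem_plusLevelOne_iff.1 hγ).1
  set g : GL (Fin 2) ℝ := Rat.archGL 2 h₀
  set u : GL (Fin 2) (AdeleRing (𝓞 ℚ) ℚ) := (Rat.ofRealGL 2 g)⁻¹ * h₀ with hudef
  have hu : u ∈ gammaOneLevel ℚ (Ideal.span {(N : 𝓞 ℚ)}) := Rat.ofRealGL_archGL_inv_mul_mem_gammaOneLevel hγ
  have hh₀' : h₀ = Rat.ofRealGL 2 g * u := by rw [hudef, mul_inv_cancel_left]
  have hL : adelicLiftFun N k f (h * t₂) = adelicLiftFun N k f (Rat.ofRealGL 2 g * t₂) := by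
    rw [hh, mul_assoc, adelicLiftFun_ofGlobal_mul, hh₀', mul_assoc, Subgroup.mem_center_iff.1 ht₂c u,
      ← mul_assoc, adelicLiftFun_mul_of_mem_gammaOneLevel f _ hu]
  have hR : adelicLiftFun N k (diamondOp N k ((natGenerator v : ℕ) : ZMod N) f) h =
      archLift k (diamondOp N k ((natGenerator v : ℕ) : ZMod N) f) g := by
    rw [hh, adelicLiftFun_ofGlobal_mul, hh₀',
      adelicLiftFun_mul_of_mem_gammaOneLevel (diamondOp N k ((natGenerator v : ℕ) : ZMod N) f) _ hu,
      adelicLiftFun_ofRealGL (diamondOp N k ((natGenerator v : ℕ) : ZMod N) f) hdet]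
  rw [hL, hR]
  -- the rational matrix `β = δ (p·1)` and the matching at the finite places
  set δ : SL(2, ℤ) := bezoutDelta a b' d' N had with hδ
  set β : GL (Fin 2) ℚ := Matrix.SpecialLinearGroup.mapGL ℚ δ * Rat.scalarPrime v with hβ
  have hβinv : β⁻¹ = Matrix.SpecialLinearGroup.mapGL ℚ δ⁻¹ * (Rat.scalarPrime v)⁻¹ := by
    rw [hβ, ← Rat.scalarPrime_mul_comm, _root_.mul_inv_rev, map_inv]
  have hγ0 : CongruenceSubgroup.Gamma0Map N ⟨δ⁻¹, bezoutDelta_inv_mem_gamma0 a b' d' N had⟩ =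
      ((natGenerator v : ℕ) : ZMod N) := by
    change ((((δ⁻¹ : SL(2, ℤ)) : Matrix (Fin 2) (Fin 2) ℤ) 1 1 : ℤ) : ZMod N) = _
    rw [hδ, bezoutDelta_inv_apply_one_one, ← Int.cast_natCast]
    exact ((ZMod.intCast_eq_intCast_iff_dvd_sub (natGenerator v : ℤ) a N).2 hap).symm
  have hβdet : 0 < (β.det : ℚ) := by
    rw [hβ, map_mul, Units.val_mul]
    refine mul_pos ?_ ?_
    · have : (Matrix.SpecialLinearGroup.mapGL ℚ δ).det.val = 1 := by
        rw [Matrix.GeneralLinearGroup.val_det_apply]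
        exact Matrix.SpecialLinearGroup.det_coe _
      rw [this]; exact one_pos
    · rw [Matrix.GeneralLinearGroup.val_det_apply, Rat.coe_scalarPrime, Matrix.det_smul, Matrix.det_one,
        mul_one, Fintype.card_fin]
      exact pow_pos (Nat.cast_pos.mpr hp.pos) 2
  have hty : Rat.archGL 2 t₂ = 1 := by
    rw [ht₂, Rat.heckeDiagAt_localUniformizer_two, Rat.archGL_ofLocal]
  have hβy : ∀ w : HeightOneSpectrum (𝓞 ℚ),
      Rat.globalToLocal 2 w β⁻¹ * GLn.localPart 2 ℚ w t₂ ∈ Rat.localGammaOne w (Ideal.span {(N : 𝓞 ℚ)}) := by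
    intro w
    rw [hβinv, ht₂, Rat.heckeDiagAt_localUniformizer_two]
    by_cases hw : w = v
    · subst hw
      rw [GLn.localPart_ofLocal, map_mul, map_inv (Rat.globalToLocal 2 _) (Rat.scalarPrime _),
        inv_mul_cancel_right]
      exact Rat.valuedCongruenceSubgroup_one_le_localGammaOne h𝔫 hv
        (Rat.globalToLocal_mapGL_mem_valuedCongruenceSubgroup_one _)
    · rw [GLn.localPart_ofLocal_of_ne hw, mul_one]
      exact Rat.globalToLocal_mapGL_mul_scalarPrime_inv_mem_localGammaOne hw
        ⟨δ⁻¹, bezoutDelta_inv_mem_gamma0 a b' d' N had⟩ hγ0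
  rw [adelicLiftFun_ofRealGL_mul_eq_archLift f hdet hβdet hty hβy]
  -- the archimedean value `archLift k f ((p·1)⁻¹ δ⁻¹ g) = archLift k (⟨p⟩ f) g`
  have hreal : (Matrix.GeneralLinearGroup.map (Rat.castHom ℝ) β)⁻¹ * g =
      (realScalarGL (natGenerator v : ℝ) hp0)⁻¹ * (Matrix.SpecialLinearGroup.mapGL ℝ δ⁻¹ * g) := by
    rw [hβ, map_mul, Rat.map_castHom_mapGL, Rat.map_castHom_scalarPrime, _root_.mul_inv_rev, map_inv, mul_assoc]
  have hδdet : (Matrix.SpecialLinearGroup.mapGL ℝ δ⁻¹).det.val = 1 := by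
    rw [Matrix.GeneralLinearGroup.val_det_apply]
    exact Matrix.SpecialLinearGroup.det_coe _
  have hXdet : 0 < (Matrix.SpecialLinearGroup.mapGL ℝ δ⁻¹ * g).det.val := by
    rw [map_mul, Units.val_mul, hδdet, one_mul]; exact hdet
  have hscal : archLift k f ((realScalarGL (natGenerator v : ℝ) hp0)⁻¹ * (Matrix.SpecialLinearGroup.mapGL ℝ δ⁻¹ * g)) =
      archLift k f (Matrix.SpecialLinearGroup.mapGL ℝ δ⁻¹ * g) := by
    have hX'det : 0 < ((realScalarGL (natGenerator v : ℝ) hp0)⁻¹ *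
        (Matrix.SpecialLinearGroup.mapGL ℝ δ⁻¹ * g)).det.val := by
      rw [map_mul, map_inv, Units.val_mul, Units.val_inv_eq_inv_val, det_realScalarGL]
      exact mul_pos (inv_pos.2 (pow_pos hp0 2)) hXdet
    have e := archLift_realScalarGL_mul k (⇑f) hp0 hX'det
    rw [mul_inv_cancel_left] at e
    exact e.symm
  rw [hreal, hscal, archLift_apply, archLift_apply, SlashAction.slash_mul, map_mul, Units.val_mul, hδdet, one_mul]
  have e : Matrix.SpecialLinearGroup.mapGL ℝ δ⁻¹ = ((δ⁻¹ : SL(2, ℤ)) : GL (Fin 2) ℝ) := rfl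
  rw [e, hδ, slash_bezoutDelta_inv_eq_diamondOp (natGenerator v) a b' d' had hap f]

end Pointwise

/-! ### The Hecke operators of `HasSatakeParamAt` on the function `φ_f` -/

section Alias

variable (N : ℕ) (k : ℤ)

/-- **`φ_f` on the trunk's function space**: `adelicLiftFun N k f` read as a function on the
syntactic type `(AdelicGroupData.gl 2 ℚ).Adelic` (definitionally `GL (Fin 2) (AdeleRing (𝓞 ℚ) ℚ)`),
on which `rightTranslation`, `heckeOperator` and the spaces `π.W` of `AutomorphicRepsGL` are typed.
[cite: Gelbart1975, (3.4)] -/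
def adelicLiftFunA (f : ℍ → ℂ) : (AdelicGroupData.gl 2 ℚ).Adelic → ℂ := adelicLiftFun N k f

/-- `adelicLiftFunA N k f g = adelicLiftFun N k f g` (definitional). [folklore] -/
@[simp] theorem adelicLiftFunA_apply (f : ℍ → ℂ) (g : (AdelicGroupData.gl 2 ℚ).Adelic) :
    adelicLiftFunA N k f g = adelicLiftFun N k f g := rfl

/-- `adelicLiftFunA N k f = adelicLiftFun N k f` as functions (definitional). [folklore] -/
theorem adelicLiftFunA_eq (f : ℍ → ℂ) :
    adelicLiftFunA N k f = (show (AdelicGroupData.gl 2 ℚ).Adelic → ℂ from adelicLiftFun N k f) := rfl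

end Alias

section Operators

variable {N : ℕ} [NeZero N] {k : ℤ} (f : CuspForm (Gamma1 N) k) {v : HeightOneSpectrum (𝓞 ℚ)}

attribute [local instance] neZero_natGenerator

/-- `φ_f` is a `K(N)`-fixed vector of the right regular action on functions. [cite: Gelbart1975, Prop. 3.1] -/
theorem adelicLiftFunA_mem_fixedPoints_principalCongruenceLevel :
    adelicLiftFunA N k f ∈ (rightTranslation (AdelicGroupData.gl 2 ℚ)).fixedPoints
      (show Subgroup (AdelicGroupData.gl 2 ℚ).Adelic from principalCongruenceLevel 2 ℚ (Ideal.span {(N : 𝓞 ℚ)})) := by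
  rw [Representation.mem_fixedPoints]
  intro u hu
  funext g
  rw [rightTranslation_apply]
  exact adelicLiftFun_mul_of_mem_principalCongruenceLevel f hu g

/-- **`T_{p,1} φ_f = φ_{T_p f} / (√p)^{k-2}`** for the Hecke operator `[K(N) diag(ϖ,1)_p K(N)]` of
`AutomorphicRepData.HasSatakeParamAt` acting on the function `φ_f`, `f ∈ S_k(Γ₁(N))` arbitrary,
`p ∤ N` (`heckeOperator_apply_eq_sum` with the transversal `{yⱼ}`, and
`sum_adelicLiftFun_mul_eq_lift_heckeT`). [cite: Gelbart1975, §3.B, (3.15) and Lemma 3.7] -/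
theorem heckeOperator_principalCongruenceLevel_adelicLiftFunA_one (hv : ¬ v.asIdeal ∣ Ideal.span {(N : 𝓞 ℚ)}) :
    heckeOperator (rightTranslation (AdelicGroupData.gl 2 ℚ))
        (show Subgroup (AdelicGroupData.gl 2 ℚ).Adelic from principalCongruenceLevel 2 ℚ (Ideal.span {(N : 𝓞 ℚ)}))
        (heckeDiagAt 2 ℚ v (Rat.localUniformizer v) 1) (adelicLiftFunA N k f) =
      ((((Real.sqrt (natGenerator v) : ℝ) : ℂ) ^ (k - 2))⁻¹) •
        adelicLiftFunA N k (EllipticCurves.ModularForms.heckeT (Gamma1 N) k (natGenerator v) f) := by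
  classical
  have h𝔫 : Ideal.span {(N : 𝓞 ℚ)} ≠ 0 := Rat.span_natCast_ne_zero N
  obtain ⟨hU1, hU2, hU3⟩ := principalCongruenceLevel_local_hyps (n := 2) (K := ℚ) (v := v) h𝔫 hv
  set Kn : Subgroup (AdelicGroupData.gl 2 ℚ).Adelic := principalCongruenceLevel 2 ℚ (Ideal.span {(N : 𝓞 ℚ)}) with hKn
  set y : Option (Fin (natGenerator v)) → (AdelicGroupData.gl 2 ℚ).Adelic := fun j => GLn.ofLocal 2 ℚ v
    (heckeLocalRep (Rat.localUniformizer v : v.adicCompletion ℚ)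
      (fun i : Fin (natGenerator v) => algebraMap ℚ (v.adicCompletion ℚ) ((i : ℕ) : ℚ))
      (Rat.localUniformizer v).ne_zero j) with hy
  have hinj : Function.Injective y := Rat.ofLocal_heckeLocalRep_injective hv
  have hs : Set.BijOn (fun x : (AdelicGroupData.gl 2 ℚ).Adelic => (x : (AdelicGroupData.gl 2 ℚ).Adelic ⧸ Kn))
      ↑(Finset.univ.image y) (MulAction.orbit Kn
        (QuotientGroup.mk (s := Kn) (heckeDiagAt 2 ℚ v (Rat.localUniformizer v) 1))) := by
    have h := Rat.bijOn_range_ofLocal_heckeLocalRep hU1 hU2 hU3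
    rwa [Finset.coe_image, Finset.coe_univ, Set.image_univ]
  rw [heckeOperator_apply_eq_sum _ Kn _ _ hs (adelicLiftFunA_mem_fixedPoints_principalCongruenceLevel f),
    Finset.sum_image fun i _ j _ h => hinj h]
  funext x
  rw [Finset.sum_apply, Pi.smul_apply, smul_eq_mul]
  simp only [rightTranslation_apply, adelicLiftFunA_apply]
  have h := sum_adelicLiftFun_mul_eq_lift_heckeT f hv x
  rw [div_eq_inv_mul] at h
  exact h

/-- **`T_{p,2} φ_f = φ_{⟨p⟩ f}`** for the Hecke operator `[K(N) diag(ϖ,ϖ)_p K(N)]` (central) acting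
on the function `φ_f`, `f ∈ S_k(Γ₁(N))` arbitrary, `p ∤ N`
(`heckeOperator_apply_of_mem_center` and `adelicLiftFun_mul_heckeDiagAt_two_eq_lift_diamondOp`).
[cite: Bump1997, §3.6, (6.4)] -/
theorem heckeOperator_principalCongruenceLevel_adelicLiftFunA_two (hv : ¬ v.asIdeal ∣ Ideal.span {(N : 𝓞 ℚ)}) :
    heckeOperator (rightTranslation (AdelicGroupData.gl 2 ℚ))
        (show Subgroup (AdelicGroupData.gl 2 ℚ).Adelic from principalCongruenceLevel 2 ℚ (Ideal.span {(N : 𝓞 ℚ)}))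
        (heckeDiagAt 2 ℚ v (Rat.localUniformizer v) 2) (adelicLiftFunA N k f) =
      adelicLiftFunA N k (diamondOp N k ((natGenerator v : ℕ) : ZMod N) f) := by
  set Kn : Subgroup (AdelicGroupData.gl 2 ℚ).Adelic := principalCongruenceLevel 2 ℚ (Ideal.span {(N : 𝓞 ℚ)}) with hKn
  rw [heckeOperator_apply_of_mem_center _ Kn (heckeDiagAt_self_mem_center (n := 2) v (Rat.localUniformizer v))
    (adelicLiftFunA_mem_fixedPoints_principalCongruenceLevel f)]
  funext x
  rw [rightTranslation_apply, adelicLiftFunA_apply, adelicLiftFunA_apply]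
  exact adelicLiftFun_mul_heckeDiagAt_two_eq_lift_diamondOp f hv x

end Operators

end Literature.NumberTheory.Automorphic

end
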